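import Summits.QuantumFields.BalabanUV.Beta.GAN24.MixedInsertionVolumeLimit
import Summits.QuantumFields.BalabanUV.Beta.GAN24.InsertionChainLawWords
import Summits.QuantumFields.BalabanUV.Beta.GAN24.ConstantBackgroundVolumeLimit

/-!
# `BalabanUV.Beta.GAN24.InsertionWordVolumeLimit` — binder row G-an2-4 ∕ (CONV-C), route R7 «TWO CURRENCIES», PART 159: EVERY MIXED INSERTION WORD
# `X_{w,k} = L^{dk}Q_k(𝒢P(V_{i₁})𝒢P(V_{i₂})⋯𝒢P(V_{i_n})𝒢)Q_kᴴ` (`w = [i₁,…,i_n]` ANY word over ANY family `(V_i)_{i ∈ σ}` of Lipschitz backgrounds) HAS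
# (UD)+(SR) VOLUME-FREE AND EL₂ MODULO ONLY THE BACKGROUNDS' POINTWISE LIMITS; HENCE `c_k⁻¹X_{w,k}c_k⁻¹` HAS THE β-CELL's WHOLE `LimitRate` END ON `ℤ^d`.
# These words are ALL the constituents of the background Taylor expansion of the (1.65)-dictionary effective form `Σ_k(t) = c_k(t)⁻¹ − a″1`,
# `c_k(t) = L^{dk}Q_k(Δ_a + Σ_i t_iP(V_i))⁻¹Q_kᴴ`, to EVERY order and in EVERY mix of directions (PART 122: `∂_{t_{i₁}}⋯∂_{t_{i_n}}(Δ_a + Σ t_iP_i)⁻¹|₀ = (−1)^n Σ_{orderings} T_w`);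
# PARTs 147 ∕ 156 ∕ 158 are the words of length `1`, the constant words, and the words of length `2`.  §1 is GENERIC (any fibre, any volume sequence): tail words
# `R_w = foldr (A_i·—) 1 w` of left-window-decaying fine kernels with pair entry limits are bounded volume-free and have pair entry limits (`List` induction over PART 144's
# `tendsto_mul_pair'` and PART 146's `norm_mul_apply_le_of_window`; the empty word is the identity, whose readings at two fixed integer points are eventually the Kronecker delta);
# §2 runs it on `A_i = P(V_i)𝒢` (PART 151's stencil lemmas) and lifts to the unit lattice (PART 151's middle-free stencil); §3 is the decay half: the conjugated bound
# `‖c(T_w)‖ ≤ γ_w⁻¹κ_c^{|w|}` (conjugation is multiplicative), PART 122's `towerLimitRate_word` on Bałaban's tower, PART 126's dictionary, `decayRate_of_towerLimitRate`; §4 packages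
# the INPUT triple and concludes with PART 143's insertion socket (unit b2b-balaban-gan24-p3, gen 56; v1)

NOT IN PRINT; OUR PROOF ([folklore] bookkeeping BY NAME over PART 144 (`tendsto_mul_pair'`), PART 146 (`norm_mul_apply_le_of_window`, `tendsto_calGlev_pair`), PART 145
(`exists_fineWindowDecay_calGlev`), PART 148 (`eventually_castT_eq_iff`), PART 151 (`norm_Pmodel_mul_apply_le`, `tendsto_Pmodel_mul_pair`, `tendsto_avgTow_pair_of_fine`), PART 122
(`chain_eq_mul_tailProd`, `towerLimitRate_word`), NE2's `freeTowerLaws_balaban` ∕ `perturbationLaws_firstOrder` ∕ `conjMat_mul_same` ∕ `conjMat_one` ∕ `opNorm_conjMat_inv_le_of_wCoercive`,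
PART 124 (`exists_admissible_rate`, `hPc_firstOrder`), PART 126 (`hdecB_of_conjBound`), `decayRate_of_towerLimitRate`, PART 143 (`conv_insertion_invCov_of_kernel`); [Balaban1987RG1]
(1.21)–(1.22) p. 264 LOCATE the shapes; nothing printed is a hypothesis).
HONEST FRAMING (cell contract, verbatim): «discharging `BetaPertH` makes Bałaban's UV stability UNCONDITIONAL — a real constructive-QFT result; it is NOT the
continuum limit and NOT the Clay problem.»  HONEST DEPENDENCY (verbatim): «continuum YM on T⁴ ⇐ BetaPertH ∧ nine spine estimates (0/9 proved); BetaPertH ⇐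
(D1) ∧ (D4) ∧ CAP+tail; G-an2-4 gates asym, D1 and NE2/3/4.»

WHAT THIS FILE PROVES (0 sorry, 0 `def`; `𝒢 = calGlev = Δ_a⁻¹`, `P(V) = Pmodel V`, `T_{w,k} = foldr (fun i N ↦ 𝒢_kP(V_i)_kN) 𝒢_k w`, `X_{w,k} = avgTow QBlev (L^d) (k ↦ T_{w,k}) k`,
`c_k = unitCovB k`, `e = unitIdx⁻¹`; words are `List.foldr`, no definition introduced):
* §1 (GENERIC; fibre `F`, `side t → ∞`) `tendsto_one_pair`; **`tailWord_bound_tendsto`** (left-window decay `(C_A, δ)` + EL₂ of every `A_i` ⟹ `R_w = foldr (A_i·—) 1 w` is bounded by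
  `(C_A·|F|·Σ_y e^{−δ|y|₁})^{|w|}` volume-free and has EL₂, every `w`); `tendsto_mul_tailWord_pair` (EL₂ of `G·R_w` for `G` left-window-decaying with EL₂).
* §2 (`d ≥ 3`, even cubic volumes, Lipschitz backgrounds with common `(α, β)`, EL₁ of every `V_i` DISPLAYED) **`tendsto_word_fine_pair`** (EL₂ of `T_{w,k}` at fine integer pairs),
  **`tendsto_word_pair`** (EL₂ of `X_{w,k}` at unit integer pairs) — EVERY word.
* §3 (`L ≥ 2`, `d ≥ 1`, EVERY torus) `opNorm_conjMat_word_le` (`‖c(T_w)‖ ≤ γ_w⁻¹κ_c^{|w|}`), **`wordInsertion_decay_inputs`** (`∃ κ > 0, B, B′ ≥ 0` from `(d, L, a, α, β, |w|)`: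
  (UD) `EntryDecay distK X_{w,k} B κ` ∀ `k`, (SR) `TwoLevelDecayRate distK X_w B′ κ (√(L⁻¹))`, volume-free, every family of Lipschitz backgrounds).
* §4 **`wordInsertion_inputs`** (the INPUT triple of PART 156's `mul_inputs` for `X_w` along the even cubic volumes), **`conv_wordInsertion_of_tendsto_background`** (`μ ≠ ν`:
  the β-cell's whole `LimitRate` END for `c_k⁻¹X_{w,k}c_k⁻¹` on `ℤ^d` MODULO ONLY EL₁ of the backgrounds) — EVERY word.
WHAT IT DOES NOT DO: products of several words with several `c_k⁻¹` (PART 160, by `mul_inputs`); the identification of Taylor coefficients of `Σ_k(t)` with signed sums of such products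
(Faà di Bruno for the inverse; PART 121 is order two); `U ≠ 1` base points; `d ≤ 2` ∕ odd volumes; Bałaban's `Π⁰_{k+1}` (row an1's dictionary).  SUPPLIER work; NEVER «G-an2-4 closed»;
NOT (CONV-C), NOT D1, NOT `BetaPertH`, NOT continuum, NOT Clay.  Records: `HOME/b2b-balaban-gan24-p3/gen56/README.md`.
-/

noncomputable section

open scoped BigOperators ComplexConjugate Matrix Matrix.Norms.L2Operator
open Filter Topology

namespace Summit.QuantumFields.BalabanUV.Beta.GAN24.InsertionWordVolumeLimit

open Literature.MathematicalPhysics.QuantumFieldTheory.Balaban1983to89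
open Literature.MathematicalPhysics.QuantumFieldTheory.Balaban1983to89.B5Prop11Plancherel (Tor fine Cst Cst_nonneg)
open Literature.MathematicalPhysics.QuantumFieldTheory.Balaban1983to89.B5G183RateUnitTower (lev)
open Literature.MathematicalPhysics.QuantumFieldTheory.Balaban1983to89.B12Sec2to5 (l1 betaPrime510)
open Literature.MathematicalPhysics.QuantumFieldTheory.Balaban1983to89.Beta (Site windowMap IsInfiniteVolumeLimit)
open Literature.MathematicalPhysics.QuantumFieldTheory.Balaban1983to89.Beta.FreeLegDictionary (cubic)
open Literature.MathematicalPhysics.QuantumFieldTheory.Balaban1983to89.Beta.BlockKernelVolumeSockets (evenPeriod tendsto_evenPeriod)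
open Literature.MathematicalPhysics.QuantumFieldTheory.Balaban1983to89.Beta.VectorTails (castT)
open Literature.MathematicalPhysics.QuantumFieldTheory.Balaban1983to89.Beta.LimitRate (StepRate limKernelOf KernelInputs)
open Summit.QuantumFields.BalabanUV.T4Continuum
open Summit.QuantumFields.BalabanUV.T4Continuum.BackgroundResolventLaw (l2_opNorm_one_le)
open Summit.QuantumFields.BalabanUV.T4Continuum.CovariantAveragingTower (avgTow)
open Summit.QuantumFields.BalabanUV.T4Continuum.BalabanAveragedTowerUnit (idx QBlev calGlev unitCovB one_le_lev')
open Summit.QuantumFields.BalabanUV.T4Continuum.BalabanAveragedCoerciveTower (unitIdx)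
open Summit.QuantumFields.BalabanUV.T4Continuum.BalabanAveragingPairing (freeTowerLaws_balaban)
open Summit.QuantumFields.BalabanUV.T4Continuum.KingPairingPlantedLaw (calDalev calDalev_inv CJ CJ_nonneg)
open Summit.QuantumFields.BalabanUV.T4Continuum.FirstOrderBackgroundModel (LipschitzBackground Pmodel C2model perturbationLaws_firstOrder)
open Summit.QuantumFields.BalabanUV.T4Continuum.CTWeightedCoercivity (conjMat conjMat_one WCoercive)
open Summit.QuantumFields.BalabanUV.T4Continuum.CTAveragedTowerDecay (opNorm_conjMat_inv_le_of_wCoercive conjMat_mul_same)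
open Summit.QuantumFields.BalabanUV.T4Continuum.CTKingTowerWeights (rho distK)
open Summit.QuantumFields.BalabanUV.T4Continuum.CTConjugatedHbd (G2 G2_nonneg wCoercive_calDa_of_conjDefect)
open Summit.QuantumFields.BalabanUV.T4Continuum.CTConjDefectDischarge (conjDefect_calDalev_rho max_JA_lt_gamD)
open Summit.QuantumFields.BalabanUV.T4Continuum.DirichletRegionTower (gamD)
open Summit.QuantumFields.BalabanUV.T4Continuum.CTVectorPropagator (JA)
open Summit.QuantumFields.BalabanUV.T4Continuum.DecayRateInterpolation (EntryDecay DecayRate TwoLevelDecayRate decayRate_of_towerLimitRate)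
open Summit.QuantumFields.BalabanUV.Beta.GAN24.DiagramDecayAlgebra (entryDecay_add)
open Summit.QuantumFields.BalabanUV.Beta.GAN24.UnitLatticeDecayAlgebra (distK_nonneg)
open Summit.QuantumFields.BalabanUV.Beta.GAN24.EffectiveFormDecay (entryDecay_of_le_rate)
open Summit.QuantumFields.BalabanUV.Beta.GAN24.InsertionChainDecay (hPc_firstOrder exists_admissible_rate)
open Summit.QuantumFields.BalabanUV.Beta.GAN24.InsertionChainDecayBalaban (hdecB_of_conjBound)
open Summit.QuantumFields.BalabanUV.Beta.GAN24.InsertionChainLawWords (chain_eq_mul_tailProd towerLimitRate_word)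
open Summit.QuantumFields.BalabanUV.Beta.GAN24.DiagramVolumeLimitPairs (l1_windowMap_neg)
open Summit.QuantumFields.BalabanUV.Beta.GAN24.DiagramVolumeLimitSandwich (conv_insertion_invCov_of_kernel)
open Summit.QuantumFields.BalabanUV.Beta.GAN24.VolumeLimitPairsFibre (tendsto_mul_pair')
open Summit.QuantumFields.BalabanUV.Beta.GAN24.FinePropagatorDecay (exists_fineWindowDecay_calGlev)
open Summit.QuantumFields.BalabanUV.Beta.GAN24.FineInsertionVolumeLimit (norm_mul_apply_le_of_window tendsto_calGlev_pair)
open Summit.QuantumFields.BalabanUV.Beta.GAN24.ConstantBackgroundVolumeLimit (eventually_castT_eq_iff)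
open Summit.QuantumFields.BalabanUV.Beta.GAN24.PerturbedPropagatorVolumeLimit (tendsto_Pmodel_mul_pair norm_Pmodel_mul_apply_le tendsto_avgTow_pair_of_fine)

variable {d : ℕ} (L : ℕ) [NeZero L] (a : ℝ) (ha : 0 < a)

/-! ## §1 Generic: tail words of left-window-decaying fine kernels with pair entry limits -/

section Generic

variable {F : Type*} [Fintype F] [DecidableEq F] {side : ℕ → ℕ} [∀ t, NeZero (side t)]

omit [Fintype F] in
/-- the readings of the IDENTITY kernel at two fixed integer points converge (they are eventually the Kronecker delta of the points — PART 148's `eventually_castT_eq_iff`):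
the empty word. [folklore] -/
theorem tendsto_one_pair (hside : Tendsto side atTop atTop) (f g : F) (z z' : Fin d → ℤ) :
    ∃ s : ℂ, Tendsto (fun t => (1 : Matrix (Site d (side t) × F) (Site d (side t) × F) ℂ) (castT (cubic d (side t)) z, f) (castT (cubic d (side t)) z', g))
      atTop (𝓝 s) := by
  classical
  refine ⟨if z = z' ∧ f = g then 1 else 0, tendsto_const_nhds.congr' ?_⟩
  filter_upwards [eventually_castT_eq_iff (d := d) hside z z'] with t ht
  by_cases h : z = z' ∧ f = g
  · rw [if_pos h]
    obtain ⟨rfl, rfl⟩ := h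
    exact (Matrix.one_apply_eq _).symm
  · rw [if_neg h]
    exact (Matrix.one_apply_ne fun e => h ⟨ht.mp (congrArg Prod.fst e), congrArg Prod.snd e⟩).symm

/-- **`tailWord_bound_tendsto` — TAIL WORDS OF LEFT-WINDOW-DECAYING KERNELS WITH PAIR ENTRY LIMITS** [folklore] (`side t → ∞`, `δ > 0`): for a family `A_i` (`i ∈ σ`) of volume-indexed
fine kernels with `‖A_{i,t}(x,f)(w,g)‖ ≤ C_A e^{−δ|w−x|_w}` (left-window decay, constants free of `i, t`) and pair entry limits at fixed integer readings (EL₂), EVERY tail word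
`R_w = foldr (fun i N ↦ A_i·N) 1 w` satisfies: (bound) `‖R_{w,t}(x,f)(y,g)‖ ≤ (C_A·|F|·Σ_{y ∈ ℤ^d} e^{−δ|y|₁})^{|w|}` for all `t`, and (EL₂) — `List` induction over PART 146's
`norm_mul_apply_le_of_window` and PART 144's `tendsto_mul_pair'`; the empty word is `tendsto_one_pair`. -/
theorem tailWord_bound_tendsto (hside : Tendsto side atTop atTop) {σ : Type*}
    {A : σ → (t : ℕ) → Matrix (Site d (side t) × F) (Site d (side t) × F) ℂ} {CA δ : ℝ} (hδ : 0 < δ) (hCA : 0 ≤ CA)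
    (hA : ∀ i t (x : Site d (side t)) (f : F) (w : Site d (side t)) (g : F), ‖A i t (x, f) (w, g)‖ ≤ CA * Real.exp (-δ * l1 (windowMap d (side t) (w - x))))
    (hAel : ∀ i (f g : F) (z z' : Fin d → ℤ), ∃ s : ℂ, Tendsto (fun t => A i t (castT (cubic d (side t)) z, f) (castT (cubic d (side t)) z', g)) atTop (𝓝 s))
    (w : List σ) :
    (∀ t (x : Site d (side t)) (f : F) (y : Site d (side t)) (g : F),
        ‖(List.foldr (fun i N => A i t * N) (1 : Matrix (Site d (side t) × F) (Site d (side t) × F) ℂ) w) (x, f) (y, g)‖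
          ≤ (CA * (Fintype.card F * ∑' y : Fin d → ℤ, Real.exp (-δ * l1 y))) ^ w.length) ∧
      (∀ (f g : F) (z z' : Fin d → ℤ), ∃ s : ℂ,
        Tendsto (fun t => (List.foldr (fun i N => A i t * N) (1 : Matrix (Site d (side t) × F) (Site d (side t) × F) ℂ) w)
          (castT (cubic d (side t)) z, f) (castT (cubic d (side t)) z', g)) atTop (𝓝 s)) := by
  have hS0 : 0 ≤ CA * (Fintype.card F * ∑' y : Fin d → ℤ, Real.exp (-δ * l1 y)) :=
    mul_nonneg hCA (mul_nonneg (Nat.cast_nonneg _) (tsum_nonneg fun _ => (Real.exp_pos _).le))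
  induction w with
  | nil =>
    refine ⟨fun t x f y g => ?_, fun f g z z' => ?_⟩
    · rw [List.foldr_nil, List.length_nil, pow_zero, Matrix.one_apply]
      split_ifs <;> simp
    · simp only [List.foldr_nil]
      exact tendsto_one_pair hside f g z z'
  | cons i w ih =>
    obtain ⟨hb, hel⟩ := ih
    refine ⟨fun t x f y g => ?_, fun f g z z' => ?_⟩
    · rw [List.foldr_cons, List.length_cons, pow_succ]
      refine (norm_mul_apply_le_of_window (side t) hδ hCA (pow_nonneg hS0 _) (hA i t) (hb t) x f y g).trans (le_of_eq ?_)
      ring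
    · simp only [List.foldr_cons]
      exact tendsto_mul_pair' (d := d) (F := F) hside (X := A i) (Y := fun t => List.foldr (fun i N => A i t * N) 1 w) (hA i) hδ hb (hAel i) hel f g z z'

/-- EL₂ of `G·R_w` for a left-window-decaying `G` with EL₂ and tail words `R_w` as in `tailWord_bound_tendsto` (PART 144's `tendsto_mul_pair'` once more). [folklore] -/
theorem tendsto_mul_tailWord_pair (hside : Tendsto side atTop atTop) {σ : Type*}
    {G : (t : ℕ) → Matrix (Site d (side t) × F) (Site d (side t) × F) ℂ} {A : σ → (t : ℕ) → Matrix (Site d (side t) × F) (Site d (side t) × F) ℂ} {C CA δ : ℝ}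
    (hδ : 0 < δ) (hCA : 0 ≤ CA)
    (hG : ∀ t (x : Site d (side t)) (f : F) (w : Site d (side t)) (g : F), ‖G t (x, f) (w, g)‖ ≤ C * Real.exp (-δ * l1 (windowMap d (side t) (w - x))))
    (hA : ∀ i t (x : Site d (side t)) (f : F) (w : Site d (side t)) (g : F), ‖A i t (x, f) (w, g)‖ ≤ CA * Real.exp (-δ * l1 (windowMap d (side t) (w - x))))
    (hGel : ∀ (f g : F) (z z' : Fin d → ℤ), ∃ s : ℂ, Tendsto (fun t => G t (castT (cubic d (side t)) z, f) (castT (cubic d (side t)) z', g)) atTop (𝓝 s))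
    (hAel : ∀ i (f g : F) (z z' : Fin d → ℤ), ∃ s : ℂ, Tendsto (fun t => A i t (castT (cubic d (side t)) z, f) (castT (cubic d (side t)) z', g)) atTop (𝓝 s))
    (w : List σ) (f g : F) (z z' : Fin d → ℤ) :
    ∃ s : ℂ, Tendsto (fun t => (G t * List.foldr (fun i N => A i t * N) (1 : Matrix (Site d (side t) × F) (Site d (side t) × F) ℂ) w)
      (castT (cubic d (side t)) z, f) (castT (cubic d (side t)) z', g)) atTop (𝓝 s) := by
  obtain ⟨hb, hel⟩ := tailWord_bound_tendsto hside hδ hCA hA hAel w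
  exact tendsto_mul_pair' (d := d) (F := F) hside (X := G) (Y := fun t => List.foldr (fun i N => A i t * N) 1 w) hG hδ hb hGel hel f g z z'

end Generic

/-! ## §2 EL₂ of every mixed insertion word, modulo the backgrounds' pointwise limits -/

section WordLimits

/-- **`tendsto_word_fine_pair` — EL₂ OF THE FINE KERNEL `T_{w,k} = 𝒢P(V_{i₁})𝒢⋯P(V_{i_n})𝒢` AT FINE INTEGER PAIRS, EVERY WORD, MODULO EL₁ OF THE BACKGROUNDS** [our proof] (`d ≥ 3`,
`a > 0`, level `k`, even cubic volumes; a family of Lipschitz backgrounds `V_{i,t}` with common `(α, β)`): `T_w = 𝒢·R_w`, `R_w = foldr (P(V_i)𝒢·—) 1 w` (PART 122's right shift);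
each letter `P(V_i)𝒢` is left-window-decaying volume-free (PART 151 on PART 145) with EL₂ (PART 151 on PART 146), so §1 applies. [cite: Balaban1987RG1, p.264 (after (1.21): the
`T ↗ ℤ^d` limit)] -/
theorem tendsto_word_fine_pair (hd : 3 ≤ d) (k : ℕ) {σ : Type*} {α β : ℝ}
    {V : σ → (t : ℕ) → (k : ℕ) → Fin d → (idx L (cubic d (evenPeriod t)) k → ℂ)} (hV : ∀ i t, LipschitzBackground L (cubic d (evenPeriod t)) (V i t) α β)
    (hV1 : ∀ i (μ f : Fin d) (z : Fin d → ℤ), ∃ s : ℂ, Tendsto (fun t => V i t k μ (castT (cubic d (lev L k * evenPeriod t)) z, f)) atTop (𝓝 s))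
    (w : List σ) (f g : Fin d) (z z' : Fin d → ℤ) :
    ∃ s : ℂ, Tendsto (fun t => (List.foldr (fun i N => calGlev L (cubic d (evenPeriod t)) a ha k * Pmodel L (cubic d (evenPeriod t)) (V i t) k * N)
        (calGlev L (cubic d (evenPeriod t)) a ha k) w)
      (castT (cubic d (lev L k * evenPeriod t)) z, f) (castT (cubic d (lev L k * evenPeriod t)) z', g)) atTop (𝓝 s) := by
  rcases isEmpty_or_nonempty σ with hσ | ⟨⟨i₀⟩⟩
  · cases w with
    | nil => simp only [List.foldr_nil]; exact tendsto_calGlev_pair L a ha hd k f g z z'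
    | cons i _ => exact (IsEmpty.false i).elim
  have hd1 : 1 ≤ d := le_trans (by norm_num) hd
  have hd0 : (0 : ℝ) < d := by exact_mod_cast lt_of_lt_of_le zero_lt_one hd1
  have hn : (0 : ℝ) < lev L k := by exact_mod_cast Nat.pos_of_ne_zero (NeZero.ne (lev L k))
  have hside : Tendsto (fun t => lev L k * evenPeriod t) atTop atTop :=
    Filter.Tendsto.const_mul_atTop' (Nat.pos_of_ne_zero (NeZero.ne (lev L k))) tendsto_evenPeriod |>.congr fun t => by ring
  have hα : 0 ≤ α := (hV i₀ 0).nonneg.1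
  obtain ⟨κ, C, hκ, hC, hdec⟩ := exists_fineWindowDecay_calGlev L a ha
  have hδ : 0 < κ / (d * lev L k) := div_pos hκ (mul_pos hd0 hn)
  have hGr : ∀ t (w : Site d (lev L k * evenPeriod t)) (g : Fin d) (y : Site d (lev L k * evenPeriod t)) (h : Fin d),
      ‖calGlev L (cubic d (evenPeriod t)) a ha k (w, g) (y, h)‖ ≤ C * Real.exp (-(κ / (d * lev L k)) * l1 (windowMap d (lev L k * evenPeriod t) (w - y))) :=
    fun t w g y h => hdec (evenPeriod t) k w y g h
  have hGl : ∀ t (x : Site d (lev L k * evenPeriod t)) (f : Fin d) (w : Site d (lev L k * evenPeriod t)) (g : Fin d),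
      ‖calGlev L (cubic d (evenPeriod t)) a ha k (x, f) (w, g)‖ ≤ C * Real.exp (-(κ / (d * lev L k)) * l1 (windowMap d (lev L k * evenPeriod t) (w - x))) := by
    intro t x f w g
    have h := hdec (evenPeriod t) k x w f g
    rwa [show x - w = -(w - x) from (neg_sub w x).symm, l1_windowMap_neg] at h
  have hGel := fun f g w w' => tendsto_calGlev_pair L a ha hd k f g w w'
  set CX : ℝ := d * (α * lev L k * ((Real.exp (3 * (κ / (d * lev L k))) + 1) * C)) with hCX
  have hCX0 : 0 ≤ CX := by positivity
  -- the letters `A_i = P(V_i)𝒢`: left-window decay and EL₂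
  have hXdecl : ∀ i t (x : Site d (lev L k * evenPeriod t)) (f : Fin d) (w : Site d (lev L k * evenPeriod t)) (g : Fin d),
      ‖(Pmodel L (cubic d (evenPeriod t)) (V i t) k * calGlev L (cubic d (evenPeriod t)) a ha k) (x, f) (w, g)‖
        ≤ CX * Real.exp (-(κ / (d * lev L k)) * l1 (windowMap d (lev L k * evenPeriod t) (w - x))) := by
    intro i t x f w g
    have h := norm_Pmodel_mul_apply_le L (evenPeriod t) (hV i t) k hC hδ.le (hGr t) x f w g
    rwa [show x - w = -(w - x) from (neg_sub w x).symm, l1_windowMap_neg] at h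
  have hXel : ∀ i (f g : Fin d) (z z' : Fin d → ℤ), ∃ s : ℂ, Tendsto (fun t => (Pmodel L (cubic d (evenPeriod t)) (V i t) k * calGlev L (cubic d (evenPeriod t)) a ha k)
      (castT (cubic d (lev L k * evenPeriod t)) z, f) (castT (cubic d (lev L k * evenPeriod t)) z', g)) atTop (𝓝 s) :=
    fun i => tendsto_Pmodel_mul_pair L (side := evenPeriod) k (V i) (hV1 i) (G := fun t => calGlev L (cubic d (evenPeriod t)) a ha k) hGel
  -- the right shift `T_w = 𝒢·R_w`
  have e : ∀ t, List.foldr (fun i N => calGlev L (cubic d (evenPeriod t)) a ha k * Pmodel L (cubic d (evenPeriod t)) (V i t) k * N) (calGlev L (cubic d (evenPeriod t)) a ha k) w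
      = calGlev L (cubic d (evenPeriod t)) a ha k
        * List.foldr (fun i N => Pmodel L (cubic d (evenPeriod t)) (V i t) k * calGlev L (cubic d (evenPeriod t)) a ha k * N) 1 w :=
    fun t => chain_eq_mul_tailProd (calGlev L (cubic d (evenPeriod t)) a ha k) (fun i => Pmodel L (cubic d (evenPeriod t)) (V i t) k) w
  simp only [e]
  exact tendsto_mul_tailWord_pair (d := d) (F := Fin d) (side := fun t => lev L k * evenPeriod t) hside
    (G := fun t => calGlev L (cubic d (evenPeriod t)) a ha k)
    (A := fun i t => Pmodel L (cubic d (evenPeriod t)) (V i t) k * calGlev L (cubic d (evenPeriod t)) a ha k) hδ hCX0 hGl hXdecl hGel hXel w f g z z'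

/-- **`tendsto_word_pair` — EL₂ OF THE AVERAGED WORD `X_{w,k} = L^{dk}Q_kT_{w,k}Q_kᴴ` ON THE UNIT LATTICE, EVERY WORD, MODULO EL₁ OF THE BACKGROUNDS** [our proof] (`d ≥ 3`, even cubic
volumes): PART 151's middle-free stencil on `tendsto_word_fine_pair`. [cite: Balaban1987RG1, p.264 (after (1.21): the `T ↗ ℤ^d` limit)] -/
theorem tendsto_word_pair (hd : 3 ≤ d) (k : ℕ) {σ : Type*} {α β : ℝ}
    {V : σ → (t : ℕ) → (k : ℕ) → Fin d → (idx L (cubic d (evenPeriod t)) k → ℂ)} (hV : ∀ i t, LipschitzBackground L (cubic d (evenPeriod t)) (V i t) α β)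
    (hV1 : ∀ i (μ f : Fin d) (z : Fin d → ℤ), ∃ s : ℂ, Tendsto (fun t => V i t k μ (castT (cubic d (lev L k * evenPeriod t)) z, f)) atTop (𝓝 s))
    (w : List σ) (μ ν : Fin d) (z z' : Fin d → ℤ) :
    ∃ s : ℂ, Tendsto (fun t => (avgTow (QBlev L (cubic d (evenPeriod t))) ((L : ℝ) ^ d)
        (fun k' => List.foldr (fun i N => calGlev L (cubic d (evenPeriod t)) a ha k' * Pmodel L (cubic d (evenPeriod t)) (V i t) k' * N)
          (calGlev L (cubic d (evenPeriod t)) a ha k') w) k)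
      ((unitIdx L (cubic d (evenPeriod t))).symm (castT (cubic d (evenPeriod t)) z, μ)) ((unitIdx L (cubic d (evenPeriod t))).symm (castT (cubic d (evenPeriod t)) z', ν))) atTop (𝓝 s) := by
  obtain ⟨s, hs⟩ := tendsto_avgTow_pair_of_fine L k
    (X := fun t k' => List.foldr (fun i N => calGlev L (cubic d (evenPeriod t)) a ha k' * Pmodel L (cubic d (evenPeriod t)) (V i t) k' * N)
      (calGlev L (cubic d (evenPeriod t)) a ha k') w)
    (fun f g u u' => tendsto_word_fine_pair L a ha hd k hV hV1 w f g u u') μ ν z z'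
  refine ⟨s, hs.congr fun t => ?_⟩
  simp only [Matrix.reindex_apply, Matrix.submatrix_apply]

end WordLimits

/-! ## §3 (UD)+(SR) of every mixed insertion word, volume-free -/

section Decay

variable (M : Fin d → ℕ) [hM : ∀ μ, NeZero (M μ)]

/-- **the conjugated bound of a word**: `WCoercive Δ_a κ ρ γ_w`, `‖c(P_i)c(Δ_a⁻¹)‖ ≤ κ_c` for every letter ⟹ `‖c(T_w)‖ ≤ γ_w⁻¹·κ_c^{|w|}` (`T_w = Δ_a⁻¹·R_w` by PART 122's right shift;
`conjMat` is multiplicative at equal weights and fixes `1`). [folklore] -/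
theorem opNorm_conjMat_word_le {k : ℕ} {κ : ℝ} {ρ : idx L M k → ℝ} {γw κc : ℝ} {σ : Type*} {P : σ → Matrix (idx L M k) (idx L M k) ℂ}
    (hW : WCoercive (calDalev L M a ha k) κ ρ γw) (hγ : 0 < γw) (hκc : 0 ≤ κc)
    (hP : ∀ i, ‖conjMat κ ρ ρ (P i) * conjMat κ ρ ρ (calDalev L M a ha k)⁻¹‖ ≤ κc) (w : List σ) :
    ‖conjMat κ ρ ρ (List.foldr (fun i N => (calDalev L M a ha k)⁻¹ * P i * N) (calDalev L M a ha k)⁻¹ w)‖ ≤ γw⁻¹ * κc ^ w.length := by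
  have htail : ∀ w : List σ, ‖conjMat κ ρ ρ (List.foldr (fun i N => P i * (calDalev L M a ha k)⁻¹ * N) 1 w)‖ ≤ κc ^ w.length := by
    intro w
    induction w with
    | nil => rw [List.foldr_nil, conjMat_one, List.length_nil, pow_zero]; exact l2_opNorm_one_le
    | cons i w ih =>
      rw [List.foldr_cons, conjMat_mul_same, conjMat_mul_same κ ρ (P i), List.length_cons, pow_succ']
      exact (Matrix.l2_opNorm_mul _ _).trans (mul_le_mul (hP i) ih (norm_nonneg _) hκc)
  rw [chain_eq_mul_tailProd, conjMat_mul_same]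
  exact (Matrix.l2_opNorm_mul _ _).trans
    (mul_le_mul (opNorm_conjMat_inv_le_of_wCoercive hW hγ) (htail w) (norm_nonneg _) (inv_nonneg.mpr hγ.le))

end Decay

/-- **`wordInsertion_decay_inputs` — (UD)+(SR) OF EVERY MIXED INSERTION WORD, VOLUME-FREE** (`L ≥ 2`, `d ≥ 1`, `σ` non-empty, `w` any word): `∃ κ > 0, B, B′ ≥ 0` from
`(d, L, a, α, β, |w|)` such that for EVERY torus `M` and EVERY family of backgrounds with `LipschitzBackground L M (V i) α β` (all `i`): (UD) `EntryDecay distK X_{w,k} B κ` ∀ `k` and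
(SR) `TwoLevelDecayRate distK X_w B′ κ (√(L⁻¹))` — PART 122's `towerLimitRate_word` on Bałaban's tower (NE2's `freeTowerLaws_balaban` ∕ `perturbationLaws_firstOrder`) + PART 126's
dictionary on §3's conjugated bound at PART 124's admissible rate, joined by `decayRate_of_towerLimitRate`; (UD) = limit decay + the `DecayRate` clause at half the rate (PART 158 is
`w = [i₁, i₂]`, PART 156 §2 the constant words). -/
theorem wordInsertion_decay_inputs (hL : 2 ≤ L) (hd : 1 ≤ d) (α β : ℝ) {σ : Type*} [Nonempty σ] (w : List σ) :
    ∃ κ B B' : ℝ, 0 < κ ∧ 0 ≤ B ∧ 0 ≤ B' ∧ ∀ (M : Fin d → ℕ) [∀ μ, NeZero (M μ)] (V : σ → (k : ℕ) → Fin d → (idx L M k → ℂ)),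
      (∀ i, LipschitzBackground L M (V i) α β) →
      (∀ k, EntryDecay (distK L M) (avgTow (QBlev L M) ((L : ℝ) ^ d)
        (fun k => List.foldr (fun i N => calGlev L M a ha k * Pmodel L M (V i) k * N) (calGlev L M a ha k) w) k) B κ) ∧
      TwoLevelDecayRate (distK L M) (avgTow (QBlev L M) ((L : ℝ) ^ d)
        (fun k => List.foldr (fun i N => calGlev L M a ha k * Pmodel L M (V i) k * N) (calGlev L M a ha k) w)) B' κ (Real.sqrt ((L : ℝ)⁻¹)) := by
  obtain ⟨i₀⟩ := ‹Nonempty σ›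
  obtain ⟨κ, hκ0, -, hγ', hδ', hJA⟩ := exists_admissible_rate d a
  have hJγ : max (JA d a 1 κ 1) 0 < gamD d a := max_JA_lt_gamD a hJA
  set J : ℝ := max (JA d a 1 κ 1) 0 with hJ
  set κc : ℝ := d * (α * G2 d a J (gamD d a - J) κ) with hκc
  set κ₀ : ℝ := d * (α + β) * Cst d a with hκ₀
  -- the decay constant and the rate constant of the word
  set Bl : ℝ := (gamD d a - J)⁻¹ * κc ^ w.length * Real.exp (κ * 4) with hBl
  set C : ℝ := ((w.length + 1) * κ₀ ^ w.length * CJ d a + w.length * κ₀ ^ (w.length - 1) * C2model d L a α β)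
    + κ₀ ^ w.length * (2 * d * Cst d a + 2 * (d * L * Cst d a)) with hCdef
  set R : ℝ := Real.sqrt (2 * Bl * (C / (1 - (L : ℝ)⁻¹))) with hR
  set R' : ℝ := Real.sqrt (2 * Bl * (2 * C / (1 - (L : ℝ)⁻¹))) with hR'
  have hL1 : (1 : ℝ) < L := by exact_mod_cast (lt_of_lt_of_le one_lt_two hL : 1 < L)
  have hρ0 : (0 : ℝ) ≤ (L : ℝ)⁻¹ := inv_nonneg.mpr (Nat.cast_nonneg _)
  have hρ1 : ((L : ℝ)⁻¹) < 1 := inv_lt_one_of_one_lt₀ hL1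
  have hr : (0 : ℝ) < (L : ℝ) ^ d := pow_pos (lt_trans zero_lt_one hL1) d
  have hθ0 : 0 ≤ Real.sqrt ((L : ℝ)⁻¹) := Real.sqrt_nonneg _
  have hθ1 : Real.sqrt ((L : ℝ)⁻¹) ≤ 1 := by rw [Real.sqrt_le_one]; exact inv_le_one_of_one_le₀ hL1.le
  refine ⟨κ / 2, max Bl 0 + R, R', half_pos hκ0, add_nonneg (le_max_right _ _) (Real.sqrt_nonneg _), Real.sqrt_nonneg _, fun M _ V hV => ?_⟩
  obtain ⟨hα, hβ⟩ := (hV i₀).nonneg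
  have hCst := Cst_nonneg d a
  have hCJ := CJ_nonneg d a
  have hκ₀0 : 0 ≤ κ₀ := by positivity
  have hC2 : 0 ≤ C2model d L a α β := by unfold C2model; positivity
  have hC0 : 0 ≤ C := by positivity
  have hκc0 : 0 ≤ κc := by have := G2_nonneg (d := d) a J (sub_pos.mpr hJγ) κ; positivity
  -- the rate half (PART 122 on Bałaban's tower)
  have hT := towerLimitRate_word hr (freeTowerLaws_balaban L M a ha) (fun i => perturbationLaws_firstOrder L M a ha hd (hV i)) hκ₀0
    (fun k => mul_nonneg hC2 (pow_nonneg hρ0 k)) hρ1 (fun k => le_rfl) (fun k => le_rfl) (fun k => le_rfl) (fun k => le_rfl) w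
  -- the decay half (PART 126's dictionary on the conjugated bound)
  have hW : ∀ (k : ℕ) (y : idx L M 0), WCoercive (calDalev L M a ha k) κ (rho L M k y) (gamD d a - J) :=
    fun k y => wCoercive_calDa_of_conjDefect (lev L k) (one_le_lev' L k) M a ha (conjDefect_calDalev_rho L M a ha one_pos hγ' hδ' k y)
  have hPc : ∀ i (k : ℕ) (y : idx L M 0),
      ‖conjMat κ (rho L M k y) (rho L M k y) (Pmodel L M (V i) k) * conjMat κ (rho L M k y) (rho L M k y) (calDalev L M a ha k)⁻¹‖ ≤ κc :=
    fun i k y => hPc_firstOrder L M a ha (hV i) (le_max_right _ _) hJγ k y (conjDefect_calDalev_rho L M a ha one_pos hγ' hδ' k y)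
  have hdec : ∀ k, EntryDecay (distK L M) (avgTow (QBlev L M) ((L : ℝ) ^ d)
      (fun k => List.foldr (fun i N => (calDalev L M a ha k)⁻¹ * Pmodel L M (V i) k * N) (calDalev L M a ha k)⁻¹ w) k) Bl κ := by
    intro k
    have h := hdecB_of_conjBound L M (X := fun k => List.foldr (fun i N => (calDalev L M a ha k)⁻¹ * Pmodel L M (V i) k * N) (calDalev L M a ha k)⁻¹ w)
      hκ0.le (fun k y => opNorm_conjMat_word_le L a ha M (hW k y) (sub_pos.mpr hJγ) hκc0 (fun i => hPc i k y) w) k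
    rw [hBl]
    exact h
  obtain ⟨clim, -, hlim, hrate, hstep⟩ := decayRate_of_towerLimitRate hρ0 hρ1 hC0 hT hdec
  -- rewrite the family to the `calGlev` form
  have e : (fun k => List.foldr (fun i N => (calDalev L M a ha k)⁻¹ * Pmodel L M (V i) k * N) (calDalev L M a ha k)⁻¹ w)
      = fun k => List.foldr (fun i N => calGlev L M a ha k * Pmodel L M (V i) k * N) (calGlev L M a ha k) w := by
    funext k; rw [calDalev_inv]
  rw [e] at hrate hstep
  refine ⟨fun k => ?_, fun k x y => (hstep k x y).trans (le_of_eq (by rw [hR']))⟩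
  have hlim' : EntryDecay (distK L M) clim (max Bl 0) κ := fun x y => (hlim x y).trans (mul_le_mul_of_nonneg_right (le_max_left _ _) (Real.exp_pos _).le)
  have h1 : EntryDecay (distK L M) clim (max Bl 0) (κ / 2) := entryDecay_of_le_rate (distK_nonneg L M) hlim' (le_max_right _ _) (half_le_self hκ0.le)
  have h2 : EntryDecay (distK L M) (avgTow (QBlev L M) ((L : ℝ) ^ d)
      (fun k => List.foldr (fun i N => calGlev L M a ha k * Pmodel L M (V i) k * N) (calGlev L M a ha k) w) k - clim) R (κ / 2) := by
    intro x y
    refine (hrate k x y).trans ?_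
    rw [hR]
    exact mul_le_mul_of_nonneg_right (mul_le_of_le_one_right (Real.sqrt_nonneg _) (pow_le_one₀ hθ0 hθ1)) (Real.exp_pos _).le
  have e2 : avgTow (QBlev L M) ((L : ℝ) ^ d) (fun k => List.foldr (fun i N => calGlev L M a ha k * Pmodel L M (V i) k * N) (calGlev L M a ha k) w) k
      = clim + (avgTow (QBlev L M) ((L : ℝ) ^ d) (fun k => List.foldr (fun i N => calGlev L M a ha k * Pmodel L M (V i) k * N) (calGlev L M a ha k) w) k - clim) := by
    abel
  rw [e2]
  exact entryDecay_add h1 h2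

/-! ## §4 The INPUT triple of every word along the even cubic volumes; the END for `c_k⁻¹X_{w,k}c_k⁻¹` -/

/-- **`wordInsertion_inputs` — THE INPUT TRIPLE ((UD), (SR), EL₂) OF EVERY MIXED INSERTION WORD ALONG THE EVEN CUBIC VOLUMES** [our proof] (`L ≥ 2`, `d ≥ 3`, `σ` non-empty;
a family `V_{i,t}` of volume-indexed Lipschitz backgrounds with common `(α, β)` DISPLAYING ONLY EL₁): `∃ κ > 0, B, B′ ≥ 0` (free of `t, k`) with (UD)+(SR) of `X_{w,·}` on every
`cubic d (2(t+1))` and EL₂ at unit integer pairs — the format PART 156's `mul_inputs` consumes. -/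
theorem wordInsertion_inputs (hL : 2 ≤ L) (hd : 3 ≤ d) {σ : Type*} [Nonempty σ] {α β : ℝ}
    {V : σ → (t : ℕ) → (k : ℕ) → Fin d → (idx L (cubic d (evenPeriod t)) k → ℂ)} (hV : ∀ i t, LipschitzBackground L (cubic d (evenPeriod t)) (V i t) α β)
    (hV1 : ∀ i k (μ f : Fin d) (z : Fin d → ℤ), ∃ s : ℂ, Tendsto (fun t => V i t k μ (castT (cubic d (lev L k * evenPeriod t)) z, f)) atTop (𝓝 s))
    (w : List σ) :
    ∃ κ B B' : ℝ, 0 < κ ∧ 0 ≤ B ∧ 0 ≤ B' ∧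
      (∀ t k, EntryDecay (distK L (cubic d (evenPeriod t))) (avgTow (QBlev L (cubic d (evenPeriod t))) ((L : ℝ) ^ d)
        (fun k' => List.foldr (fun i N => calGlev L (cubic d (evenPeriod t)) a ha k' * Pmodel L (cubic d (evenPeriod t)) (V i t) k' * N)
          (calGlev L (cubic d (evenPeriod t)) a ha k') w) k) B κ) ∧
      (∀ t, TwoLevelDecayRate (distK L (cubic d (evenPeriod t))) (avgTow (QBlev L (cubic d (evenPeriod t))) ((L : ℝ) ^ d)
        (fun k' => List.foldr (fun i N => calGlev L (cubic d (evenPeriod t)) a ha k' * Pmodel L (cubic d (evenPeriod t)) (V i t) k' * N)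
          (calGlev L (cubic d (evenPeriod t)) a ha k') w)) B' κ (Real.sqrt ((L : ℝ)⁻¹))) ∧
      (∀ k μ ν (z z' : Fin d → ℤ), ∃ s' : ℂ, Tendsto (fun t => (avgTow (QBlev L (cubic d (evenPeriod t))) ((L : ℝ) ^ d)
        (fun k' => List.foldr (fun i N => calGlev L (cubic d (evenPeriod t)) a ha k' * Pmodel L (cubic d (evenPeriod t)) (V i t) k' * N)
          (calGlev L (cubic d (evenPeriod t)) a ha k') w) k)
        ((unitIdx L (cubic d (evenPeriod t))).symm (castT (cubic d (evenPeriod t)) z, μ)) ((unitIdx L (cubic d (evenPeriod t))).symm (castT (cubic d (evenPeriod t)) z', ν)))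
        atTop (𝓝 s')) := by
  have hd1 : 1 ≤ d := le_trans (by norm_num) hd
  obtain ⟨κ, B, B', hκ, hB, hB', h⟩ := wordInsertion_decay_inputs L a ha hL hd1 α β w
  exact ⟨κ, B, B', hκ, hB, hB', fun t k => (h (cubic d (evenPeriod t)) (fun i => V i t) (fun i => hV i t)).1 k,
    fun t => (h (cubic d (evenPeriod t)) (fun i => V i t) (fun i => hV i t)).2,
    fun k μ ν z z' => tendsto_word_pair L a ha hd k hV (fun i => hV1 i k) w μ ν z z'⟩

/-- **`conv_wordInsertion_of_tendsto_background` — THE SANDWICH `c_k⁻¹X_{w,k}c_k⁻¹` OF EVERY MIXED INSERTION WORD ON `ℤ^d`, MODULO ONLY THE BACKGROUNDS' POINTWISE LIMITS**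
[our proof] (`d ≥ 3`, `L ≥ 2`, `a > 0`, `μ ≠ ν`, even cubic volumes `2(t+1)`, `σ` non-empty, `w` ANY word): for a family of volume-indexed Lipschitz backgrounds with common
`(α, β)` DISPLAYING ONLY their EL₁, the tower `c_k⁻¹·[L^{dk}Q_k(𝒢P(V_{i₁,t})𝒢⋯P(V_{i_n,t})𝒢)Q_kᴴ]·c_k⁻¹` has `∃ κ > 0, B, B′ ≥ 0, Π` with `IsInfiniteVolumeLimit`,
`UniformDecay Π μ ν B (κ∕d)`, `StepRate Π μ ν B′ (κ∕d) (√(L⁻¹))`, `KernelInputs d Π`, `∀ k, |secondMoment (Π k) μ ν − secondMoment (limKernelOf Π) μ ν| ≤ β′_d(B′∕(1−√(L⁻¹)), κ∕d)·(√(L⁻¹))^k`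
— PART 143's insertion socket on `wordInsertion_inputs` (PART 147: `|w| = 1`; PART 158: `|w| = 2`). [cite: Balaban1987RG1, (1.21)–(1.22) p.264 (shapes)] -/
theorem conv_wordInsertion_of_tendsto_background (hL : 2 ≤ L) (hd : 3 ≤ d) {μ ν : Fin d} (hne : μ ≠ ν) {σ : Type*} [Nonempty σ] {α β : ℝ}
    {V : σ → (t : ℕ) → (k : ℕ) → Fin d → (idx L (cubic d (evenPeriod t)) k → ℂ)} (hV : ∀ i t, LipschitzBackground L (cubic d (evenPeriod t)) (V i t) α β)
    (hV1 : ∀ i k (μ f : Fin d) (z : Fin d → ℤ), ∃ s : ℂ, Tendsto (fun t => V i t k μ (castT (cubic d (lev L k * evenPeriod t)) z, f)) atTop (𝓝 s))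
    (w : List σ) :
    ∃ κ B B' : ℝ, 0 < κ ∧ 0 ≤ B ∧ 0 ≤ B' ∧ ∃ Pinf : ℕ → B12Beta.Kernel d,
      (∀ k, IsInfiniteVolumeLimit evenPeriod
        (fun t μ' ν' (z : Site d (evenPeriod t)) => (((unitCovB L (cubic d (evenPeriod t)) a ha k)⁻¹
            * avgTow (QBlev L (cubic d (evenPeriod t))) ((L : ℝ) ^ d)
                (fun k' => List.foldr (fun i N => calGlev L (cubic d (evenPeriod t)) a ha k' * Pmodel L (cubic d (evenPeriod t)) (V i t) k' * N)
                  (calGlev L (cubic d (evenPeriod t)) a ha k') w) k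
            * (unitCovB L (cubic d (evenPeriod t)) a ha k)⁻¹)
          ((unitIdx L (cubic d (evenPeriod t))).symm (z, μ')) ((unitIdx L (cubic d (evenPeriod t))).symm (0, ν'))).re) (Pinf k)) ∧
      Beta.LimitRate.UniformDecay Pinf μ ν B (κ / d) ∧ StepRate Pinf μ ν B' (κ / d) (Real.sqrt ((L : ℝ)⁻¹)) ∧
      (∃ K : KernelInputs d Pinf, K.θ = Real.sqrt ((L : ℝ)⁻¹) ∧ K.c₀ = betaPrime510 d (B' / (1 - Real.sqrt ((L : ℝ)⁻¹))) (κ / d) ∧ K.Pinf = limKernelOf Pinf ∧ K.μ = μ ∧ K.ν = ν) ∧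
      (∀ k, |B12Beta.secondMoment (Pinf k) μ ν - B12Beta.secondMoment (limKernelOf Pinf) μ ν|
          ≤ betaPrime510 d (B' / (1 - Real.sqrt ((L : ℝ)⁻¹))) (κ / d) * Real.sqrt ((L : ℝ)⁻¹) ^ k) := by
  obtain ⟨κ, B, B', hκ, hB, hB', hud, hsr, hel⟩ := wordInsertion_inputs L a ha hL hd hV hV1 w
  exact conv_insertion_invCov_of_kernel L a ha hL hd hne
    (X := fun t k => avgTow (QBlev L (cubic d (evenPeriod t))) ((L : ℝ) ^ d)
      (fun k' => List.foldr (fun i N => calGlev L (cubic d (evenPeriod t)) a ha k' * Pmodel L (cubic d (evenPeriod t)) (V i t) k' * N)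
        (calGlev L (cubic d (evenPeriod t)) a ha k') w) k)
    hκ hB hB' hud hsr hel

end Summit.QuantumFields.BalabanUV.Beta.GAN24.InsertionWordVolumeLimit

end
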